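import Literature.NumberTheory.Automorphic.ModularLambdaNome
import Literature.NumberTheory.Automorphic.GammaTwoModularFormsBasis
import HarnessLib

/-!
# Stub `stub_lambdaSmallValues` of the line `registered` (birth skeleton v5) for the crux
# `UniformAnalyticExtension` (stmt-CriticalPhenomena-6047, route `CardyUSTContinuation`)

λ-engine 3 of the Schottky reduction, the cusp estimate at `i∞` in the inverse direction: every
sufficiently small NONZERO value `w` of the modular function `λ` is attained at a point `τ` as high
in the upper half-plane as we please (`Im τ ≥ B`, and `Im τ > 0`).

Proof. This is the tree theorem
`Literature.NumberTheory.Automorphic.ModularLambda.exists_forall_exists_modularLambda_eq`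
(`GammaTwoModularFormsBasis.lean`; proved there from the nome picture of `ModularLambdaNome.lean`:
`Λ₁₆(q) = λ(τ)/16`, `q = e^{πiτ}`, is holomorphic on the unit disc with `Λ₁₆(0) = 0`,
`Λ₁₆'(0) = 1`, hence open at `q = 0`, and `|q| < e^{−πB}` forces `Im τ > B`), applied with the
height `max B 1`, so that the preimage also satisfies `Im τ ≥ 1 > 0`.
-/

noncomputable section

open Filter Topology Set Metric
open Literature.NumberTheory.Automorphic (modularLambda)

namespace Summit.CriticalPhenomena.CardyFormulaZ2.Cruxes.UniformAnalyticExtension.Birth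

/-- **stub_lambdaSmallValues** (λ-engine 3, the cusp at `i∞`): for every `B` there is `ε > 0` such
that every `w` with `0 < |w| < ε` is `λ(τ)` for some `τ` with `Im τ ≥ B` and `Im τ > 0` (small
nonzero values of `λ` are taken high in the upper half-plane; the nome map `q ↦ λ/16` is open at
`q = 0`). [folklore] -/
theorem stub_lambdaSmallValues :
    ∀ B : ℝ, ∃ ε > (0:ℝ), ∀ w : ℂ, w ≠ 0 → ‖w‖ < ε →
      ∃ τ : ℂ, B ≤ τ.im ∧ 0 < τ.im ∧ modularLambda τ = w := by
  intro B
  obtain ⟨r, hr, h⟩ :=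
    Literature.NumberTheory.Automorphic.ModularLambda.exists_forall_exists_modularLambda_eq (max B 1)
  refine ⟨r, hr, fun w hw hwr ↦ ?_⟩
  obtain ⟨τ, hτ, hτw⟩ := h w hw hwr
  exact ⟨τ, le_trans (le_max_left B 1) hτ, lt_of_lt_of_le one_pos (le_trans (le_max_right B 1) hτ),
    hτw⟩

end Summit.CriticalPhenomena.CardyFormulaZ2.Cruxes.UniformAnalyticExtension.Birth
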